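import Mathlib
import Literature.Analysis.FluidPDE.GaussianVortexPlanar
import Literature.Analysis.FluidPDE.GaussianVortexPlanarProofs
import Literature.Analysis.FluidPDE.BiotSavart2DSymmetry
import Literature.Analysis.FunctionSpaces.BMOCarlesonProofs
import Summits.AnomalousDissipation.AnomalousDissipation.Theorems.MarginalStabilityChainStretchedVortexRowsStubCoreRotationLocalSkew
import HarnessLib

/-!
# Helper `biotSavart2D_farField` toward stub `stub_coreInverse` of the line `braid-closed-large-circulation-gluing`
# (crux stmt-AnomalousDissipation-3009, `MarginalStabilityChain.StretchedVortexRows`)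

Far field of the planar Biot–Savart law `K ∗ g`, `K(z) = z^⊥/(2π|z|²)`, for densities of Gaussian class
`|g(η)| ≤ A (1 + |η|)^k G(η)`, `G(η) = (4π)⁻¹ e^{−|η|²/4}`:

  `‖(K ∗ g)(ξ)‖ ≤ C A/(1 + |ξ|)` and `|ξ · (K ∗ g)(ξ)| ≤ C A/(1 + |ξ|)`, `C = C(k)`.

Proof. `‖K(z)‖ = (2π|z|)⁻¹`, so `‖(K ∗ g)(ξ)‖ ≤ ∫ |g(η)| ‖K(ξ − η)‖ dη`; and since `z · K(z) = 0`,
`ξ · K(ξ − η) = η · K(ξ − η)`, whence `|ξ · (K ∗ g)(ξ)| ≤ ∫ |g(η)| |η| ‖K(ξ − η)‖ dη` — the radial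
component picks up the factor `|η|` (integrated against the Gaussian) instead of `|ξ|`. Both right-hand
sides are `≤ A ∫ Φ(η) ‖K(ξ − η)‖ dη` with `Φ = (1 + |η|)^{k+1} G`. The Peetre-type inequality
`1 + |ξ| ≤ (1 + |η|)(1 + |ξ − η|)` gives the pointwise majorant

  `(1 + |ξ|) Φ(η) ‖K(ξ − η)‖ ≤ (2π)⁻¹ Ψ(η) (|ξ − η|⁻¹ + 1) ≤ (2π)⁻¹ (B 𝟙_{|ξ−η|<1}|ξ − η|⁻¹ + 2Ψ(η))`,

`Ψ = (1 + |η|)^{k+2} G ≤ B` (Gaussian versus polynomial, from the tree's heat-kernel bounds), and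
`|z|⁻¹ ∈ L¹(unit disc)` (polar coordinates, tree `integrable_indicator_inv_norm`), `Ψ ∈ L¹` (landed
`integrable_one_add_norm_pow_mul_gaussVortexProfile`) give
`(1 + |ξ|) ∫ Φ(η) ‖K(ξ − η)‖ dη ≤ (2π)⁻¹ (B ∫_{|z|<1}|z|⁻¹ dz + 2‖Ψ‖₁) =: C'` uniformly in `ξ`; `C := C' + 1`.
No splitting of the domain of integration and no derivative of `K` is needed. (For `A < 0` the hypothesis is
void at `η = 0`; the proof only uses `0 ≤ A`, read off there.)

References: Th. Gallay, C. E. Wayne, J. Math. Fluid Mech. 9 (2007), (1.3) (the kernel `K`); the estimate itself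
is standard potential theory (far field of the Biot–Savart integral of a rapidly decaying density).
-/

set_option linter.dupNamespace false

noncomputable section

open scoped RealInnerProductSpace Topology ContDiff
open MeasureTheory WithLp Function Metric Filter Set

namespace Summit.AnomalousDissipation.AnomalousDissipation.Theorems.MarginalStabilityChainStretchedVortexRows

open Literature.Analysis.FluidPDE Literature.Analysis.UnboundedOperators

/-- **Gaussian versus polynomial**: `(1 + |z|)^N G(z) ≤ B_N` on `ℝ²` (`G = Γ₁`, the heat kernel at time `1`). [folklore] -/
theorem exists_bound_one_add_norm_pow_mul_gaussVortexProfile (N : ℕ) :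
    ∃ B : ℝ, 0 ≤ B ∧ ∀ z : EuclideanSpace ℝ (Fin 2), (1 + ‖z‖) ^ N * gaussVortexProfile z ≤ B := by
  obtain ⟨C, hC⟩ := Literature.Analysis.FunctionSpaces.BMOInv.exists_bound_one_add_norm_pow_mul_heatKernel
    (E := EuclideanSpace ℝ (Fin 2)) (t := 1) one_pos 0 N
  refine ⟨max C 0, le_max_right _ _, fun z => ?_⟩
  have hK : Literature.Analysis.FunctionSpaces.BMOInv.heatKernel (E := EuclideanSpace ℝ (Fin 2)) 1 (0 - z) =
      gaussVortexProfile z := by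
    rw [gaussVortexProfile_eq_heatKernel]
    change heatKernel (E := EuclideanSpace ℝ (Fin 2)) 1 (0 - z) = heatKernel 1 z
    rw [heatKernel_eq, heatKernel_eq, zero_sub, norm_neg]
  have h := hC z
  rw [hK] at h
  exact h.trans (le_max_left _ _)

/-- The Peetre-type inequality `1 + |ξ| ≤ (1 + |η|)(1 + |ξ − η|)`. [folklore] -/
theorem one_add_norm_le_mul_one_add_norm_sub (ξ η : EuclideanSpace ℝ (Fin 2)) :
    1 + ‖ξ‖ ≤ (1 + ‖η‖) * (1 + ‖ξ - η‖) := by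
  have h := norm_le_norm_add_norm_sub' ξ η
  nlinarith [norm_nonneg η, norm_nonneg (ξ - η)]

/-- The radial component of the Biot–Savart kernel: `ξ · K(ξ − η) = η · K(ξ − η)` (since `z · K(z) = 0`). [folklore] -/
theorem inner_biotSavartKernel2D_sub_left (ξ η : EuclideanSpace ℝ (Fin 2)) :
    ⟪ξ, biotSavartKernel2D (ξ - η)⟫ = ⟪η, biotSavartKernel2D (ξ - η)⟫ := by
  have h0 : ⟪ξ - η, biotSavartKernel2D (ξ - η)⟫ = 0 := by
    rw [biotSavartKernel2D, inner_smul_right, inner_self_perp, mul_zero]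
  rw [inner_sub_left] at h0
  linarith

/-- **Far-field majorant of the weighted Biot–Savart kernel.** For `0 ≤ Φ` with `(1 + |η|) Φ(η) ≤ B`,
`(1 + |ξ|) Φ(η) ‖K(ξ − η)‖ ≤ (2π)⁻¹ (B 𝟙_{|ξ−η|<1} |ξ − η|⁻¹ + 2 (1 + |η|) Φ(η))`
(Peetre's inequality and the near/far split of `|ξ − η|⁻¹` at radius `1`). [folklore] -/
theorem one_add_norm_mul_mul_norm_biotSavartKernel2D_le {Φ : EuclideanSpace ℝ (Fin 2) → ℝ} {B : ℝ}
    (hΦ0 : ∀ η, 0 ≤ Φ η) (hΦB : ∀ η, (1 + ‖η‖) * Φ η ≤ B) (ξ η : EuclideanSpace ℝ (Fin 2)) :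
    (1 + ‖ξ‖) * (Φ η * ‖biotSavartKernel2D (ξ - η)‖) ≤
      (2 * Real.pi)⁻¹ * (B * indicator (ball (0 : EuclideanSpace ℝ (Fin 2)) 1) (fun z => ‖z‖⁻¹) (ξ - η) +
        2 * ((1 + ‖η‖) * Φ η)) := by
  have hB0 : 0 ≤ B := (mul_nonneg (by positivity) (hΦ0 η)).trans (hΦB η)
  have hind0 : 0 ≤ indicator (ball (0 : EuclideanSpace ℝ (Fin 2)) 1) (fun z => ‖z‖⁻¹) (ξ - η) :=
    indicator_inv_norm_nonneg (ξ - η)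
  have hΨ0 : 0 ≤ (1 + ‖η‖) * Φ η := mul_nonneg (by positivity) (hΦ0 η)
  rw [norm_biotSavartKernel2D]
  by_cases hd : ξ - η = 0
  · rw [hd, norm_zero, inv_zero, mul_zero, mul_zero, mul_zero, indicator_of_mem (mem_ball_self one_pos),
      norm_zero, inv_zero, mul_zero, zero_add]
    positivity
  have hdpos : 0 < ‖ξ - η‖ := norm_pos_iff.2 hd
  have step1 : (1 + ‖ξ‖) * (Φ η * ((2 * Real.pi)⁻¹ * ‖ξ - η‖⁻¹)) ≤
      (2 * Real.pi)⁻¹ * ((1 + ‖η‖) * Φ η * ‖ξ - η‖⁻¹ + (1 + ‖η‖) * Φ η) := by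
    calc (1 + ‖ξ‖) * (Φ η * ((2 * Real.pi)⁻¹ * ‖ξ - η‖⁻¹))
        ≤ (1 + ‖η‖) * (1 + ‖ξ - η‖) * (Φ η * ((2 * Real.pi)⁻¹ * ‖ξ - η‖⁻¹)) :=
          mul_le_mul_of_nonneg_right (one_add_norm_le_mul_one_add_norm_sub ξ η)
            (mul_nonneg (hΦ0 η) (by positivity))
      _ = (2 * Real.pi)⁻¹ * ((1 + ‖η‖) * Φ η * ‖ξ - η‖⁻¹ + (1 + ‖η‖) * Φ η * (‖ξ - η‖ * ‖ξ - η‖⁻¹)) := by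
          ring
      _ = (2 * Real.pi)⁻¹ * ((1 + ‖η‖) * Φ η * ‖ξ - η‖⁻¹ + (1 + ‖η‖) * Φ η) := by
          rw [mul_inv_cancel₀ hdpos.ne', mul_one]
  have step2 : (1 + ‖η‖) * Φ η * ‖ξ - η‖⁻¹ ≤
      B * indicator (ball (0 : EuclideanSpace ℝ (Fin 2)) 1) (fun z => ‖z‖⁻¹) (ξ - η) + (1 + ‖η‖) * Φ η := by
    by_cases h1 : ‖ξ - η‖ < 1
    · rw [indicator_of_mem (mem_ball_zero_iff.2 h1)]
      have h2 : (1 + ‖η‖) * Φ η * ‖ξ - η‖⁻¹ ≤ B * ‖ξ - η‖⁻¹ :=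
        mul_le_mul_of_nonneg_right (hΦB η) (inv_pos.2 hdpos).le
      linarith
    · rw [indicator_of_notMem (by rwa [mem_ball_zero_iff]), mul_zero, zero_add]
      have h2 : ‖ξ - η‖⁻¹ ≤ 1 := inv_le_one_of_one_le₀ (not_lt.1 h1)
      calc (1 + ‖η‖) * Φ η * ‖ξ - η‖⁻¹ ≤ (1 + ‖η‖) * Φ η * 1 := by gcongr
        _ = (1 + ‖η‖) * Φ η := mul_one _
  calc (1 + ‖ξ‖) * (Φ η * ((2 * Real.pi)⁻¹ * ‖ξ - η‖⁻¹))
      ≤ (2 * Real.pi)⁻¹ * ((1 + ‖η‖) * Φ η * ‖ξ - η‖⁻¹ + (1 + ‖η‖) * Φ η) := step1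
    _ ≤ (2 * Real.pi)⁻¹ *
        (B * indicator (ball (0 : EuclideanSpace ℝ (Fin 2)) 1) (fun z => ‖z‖⁻¹) (ξ - η) + (1 + ‖η‖) * Φ η +
          (1 + ‖η‖) * Φ η) := by gcongr
    _ = (2 * Real.pi)⁻¹ * (B * indicator (ball (0 : EuclideanSpace ℝ (Fin 2)) 1) (fun z => ‖z‖⁻¹) (ξ - η) +
        2 * ((1 + ‖η‖) * Φ η)) := by ring

/-- W3-B (far field of the planar Biot–Savart law for Gaussian-class densities, zeroth and first order):
`‖K∗g(ξ)‖ ≤ C A/(1+|ξ|)` and `|ξ·K∗g(ξ)| ≤ C A/(1+|ξ|)` (the radial component decays one order faster: `ξ·K(ξ) = 0`). -/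
theorem biotSavart2D_farField :
    ∀ k : ℕ, ∃ C : ℝ, 0 < C ∧ ∀ (A : ℝ) (g : EuclideanSpace ℝ (Fin 2) → ℝ), Continuous g →
      (∀ η, |g η| ≤ A * (1 + ‖η‖) ^ k * gaussVortexProfile η) →
      ∀ ξ, ‖biotSavart2D g ξ‖ ≤ C * A / (1 + ‖ξ‖) ∧ |⟪ξ, biotSavart2D g ξ⟫| ≤ C * A / (1 + ‖ξ‖) := by
  intro k
  obtain ⟨B, hB0, hB⟩ := exists_bound_one_add_norm_pow_mul_gaussVortexProfile (k + 2)
  obtain ⟨B', hB'0, hB'⟩ := exists_bound_one_add_norm_pow_mul_gaussVortexProfile k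
  -- the two absolute constants `I₀ = ∫ 𝟙_{|z|<1}|z|⁻¹` and `M = ‖(1+|η|)^{k+2} G‖₁`
  set I₀ : ℝ := ∫ z, indicator (ball (0 : EuclideanSpace ℝ (Fin 2)) 1) (fun z => ‖z‖⁻¹) z with hI₀
  set M : ℝ := ∫ η : EuclideanSpace ℝ (Fin 2), (1 + ‖η‖) ^ (k + 2) * gaussVortexProfile η with hM
  have hI₀0 : 0 ≤ I₀ := integral_nonneg indicator_inv_norm_nonneg
  have hM0 : 0 ≤ M :=
    integral_nonneg fun η => mul_nonneg (by positivity) (gaussVortexProfile_pos η).le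
  have hc0 : 0 ≤ (2 * Real.pi)⁻¹ * (B * I₀ + 2 * M) := by positivity
  refine ⟨(2 * Real.pi)⁻¹ * (B * I₀ + 2 * M) + 1, by positivity, ?_⟩
  intro A g hg hgA ξ
  -- `0 ≤ A` (read off at `η = 0`)
  have hA : 0 ≤ A := by
    have h0 := hgA 0
    have hG0 := gaussVortexProfile_pos (0 : EuclideanSpace ℝ (Fin 2))
    rw [norm_zero, add_zero, one_pow, mul_one] at h0
    nlinarith [abs_nonneg (g 0)]
  have hξ : 0 < 1 + ‖ξ‖ := by positivity
  -- `g ∈ L¹ ∩ L^∞`, so the Biot–Savart integral converges absolutely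
  have hgi : Integrable g :=
    integrable_of_le_one_add_norm_pow_mul_gauss hg (A := A) (N := k) fun z => by
      rw [Real.norm_eq_abs, ← mul_assoc]; exact hgA z
  have hgb : ∀ y, |g y| ≤ A * B' := fun y =>
    (hgA y).trans (by rw [mul_assoc]; exact mul_le_mul_of_nonneg_left (hB' y) hA)
  have hK : Integrable fun η => g η • biotSavartKernel2D (ξ - η) :=
    integrable_smul_biotSavartKernel2D hgi hgb ξ
  -- the integrable majorant
  set bound : EuclideanSpace ℝ (Fin 2) → ℝ := fun η => A * ((1 + ‖ξ‖)⁻¹ * ((2 * Real.pi)⁻¹ *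
    (B * indicator (ball (0 : EuclideanSpace ℝ (Fin 2)) 1) (fun z => ‖z‖⁻¹) (ξ - η) +
      2 * ((1 + ‖η‖) ^ (k + 2) * gaussVortexProfile η)))) with hbound
  have hIi : Integrable fun η => indicator (ball (0 : EuclideanSpace ℝ (Fin 2)) 1) (fun z => ‖z‖⁻¹) (ξ - η) :=
    integrable_indicator_inv_norm.comp_sub_left ξ
  have hMi : Integrable fun η : EuclideanSpace ℝ (Fin 2) => (1 + ‖η‖) ^ (k + 2) * gaussVortexProfile η :=
    integrable_one_add_norm_pow_mul_gaussVortexProfile (k + 2)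
  have hbi : Integrable bound := (((hIi.const_mul B).add (hMi.const_mul 2)).const_mul _).const_mul _ |>.const_mul A
  have hbint : ∫ η, bound η = A * ((1 + ‖ξ‖)⁻¹ * ((2 * Real.pi)⁻¹ * (B * I₀ + 2 * M))) := by
    simp only [hbound]
    rw [integral_const_mul, integral_const_mul, integral_const_mul, integral_add (hIi.const_mul B) (hMi.const_mul 2),
      integral_const_mul, integral_const_mul,
      integral_sub_left_eq_self (indicator (ball (0 : EuclideanSpace ℝ (Fin 2)) 1) fun z => ‖z‖⁻¹) volume ξ]
  have hfin : ∫ η, bound η ≤ ((2 * Real.pi)⁻¹ * (B * I₀ + 2 * M) + 1) * A / (1 + ‖ξ‖) := by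
    rw [hbint, div_eq_mul_inv]
    have h1 : 0 ≤ (1 + ‖ξ‖)⁻¹ := by positivity
    have h2 : A * ((2 * Real.pi)⁻¹ * (B * I₀ + 2 * M)) ≤ ((2 * Real.pi)⁻¹ * (B * I₀ + 2 * M) + 1) * A := by
      nlinarith
    calc A * ((1 + ‖ξ‖)⁻¹ * ((2 * Real.pi)⁻¹ * (B * I₀ + 2 * M)))
        = A * ((2 * Real.pi)⁻¹ * (B * I₀ + 2 * M)) * (1 + ‖ξ‖)⁻¹ := by ring
      _ ≤ ((2 * Real.pi)⁻¹ * (B * I₀ + 2 * M) + 1) * A * (1 + ‖ξ‖)⁻¹ :=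
          mul_le_mul_of_nonneg_right h2 h1
  -- the pointwise majorant `A (1+|η|)^{k+1} G(η) ‖K(ξ−η)‖ ≤ bound η`
  have hpt : ∀ η, A * (1 + ‖η‖) ^ (k + 1) * gaussVortexProfile η * ‖biotSavartKernel2D (ξ - η)‖ ≤ bound η := by
    intro η
    have hkey := one_add_norm_mul_mul_norm_biotSavartKernel2D_le
      (Φ := fun η => (1 + ‖η‖) ^ (k + 1) * gaussVortexProfile η) (B := B)
      (fun η => mul_nonneg (by positivity) (gaussVortexProfile_pos η).le)
      (fun η => by
        calc (1 + ‖η‖) * ((1 + ‖η‖) ^ (k + 1) * gaussVortexProfile η)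
            = (1 + ‖η‖) ^ (k + 2) * gaussVortexProfile η := by ring
          _ ≤ B := hB η) ξ η
    have hΨ : (1 + ‖η‖) * ((1 + ‖η‖) ^ (k + 1) * gaussVortexProfile η) =
        (1 + ‖η‖) ^ (k + 2) * gaussVortexProfile η := by ring
    rw [hΨ] at hkey
    have h3 : (1 + ‖η‖) ^ (k + 1) * gaussVortexProfile η * ‖biotSavartKernel2D (ξ - η)‖ ≤
        (1 + ‖ξ‖)⁻¹ * ((2 * Real.pi)⁻¹ *
          (B * indicator (ball (0 : EuclideanSpace ℝ (Fin 2)) 1) (fun z => ‖z‖⁻¹) (ξ - η) +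
            2 * ((1 + ‖η‖) ^ (k + 2) * gaussVortexProfile η))) := by
      rw [le_inv_mul_iff₀ hξ]
      exact hkey
    calc A * (1 + ‖η‖) ^ (k + 1) * gaussVortexProfile η * ‖biotSavartKernel2D (ξ - η)‖
        = A * ((1 + ‖η‖) ^ (k + 1) * gaussVortexProfile η * ‖biotSavartKernel2D (ξ - η)‖) := by ring
      _ ≤ bound η := mul_le_mul_of_nonneg_left h3 hA
  have hmono : ∀ η, A * (1 + ‖η‖) ^ k * gaussVortexProfile η * ((1 + ‖η‖) * ‖biotSavartKernel2D (ξ - η)‖) ≤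
      bound η := fun η =>
    calc A * (1 + ‖η‖) ^ k * gaussVortexProfile η * ((1 + ‖η‖) * ‖biotSavartKernel2D (ξ - η)‖)
        = A * (1 + ‖η‖) ^ (k + 1) * gaussVortexProfile η * ‖biotSavartKernel2D (ξ - η)‖ := by ring
      _ ≤ bound η := hpt η
  have hgA0 : ∀ η, 0 ≤ A * (1 + ‖η‖) ^ k * gaussVortexProfile η := fun η =>
    mul_nonneg (mul_nonneg hA (by positivity)) (gaussVortexProfile_pos η).le
  -- (i) the velocity
  have h1 : ∀ η, ‖g η • biotSavartKernel2D (ξ - η)‖ ≤ bound η := by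
    intro η
    rw [norm_smul, Real.norm_eq_abs]
    have hle : ‖biotSavartKernel2D (ξ - η)‖ ≤ (1 + ‖η‖) * ‖biotSavartKernel2D (ξ - η)‖ :=
      le_mul_of_one_le_left (norm_nonneg _) (by linarith [norm_nonneg η])
    exact (mul_le_mul (hgA η) hle (norm_nonneg _) (hgA0 η)).trans (hmono η)
  -- (ii) the radial component
  have h2 : ∀ η, ‖⟪ξ, g η • biotSavartKernel2D (ξ - η)⟫‖ ≤ bound η := by
    intro η
    rw [inner_smul_right, inner_biotSavartKernel2D_sub_left, norm_mul, Real.norm_eq_abs, Real.norm_eq_abs]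
    have hle : |⟪η, biotSavartKernel2D (ξ - η)⟫| ≤ (1 + ‖η‖) * ‖biotSavartKernel2D (ξ - η)‖ :=
      (abs_real_inner_le_norm _ _).trans
        (mul_le_mul_of_nonneg_right (by linarith [norm_nonneg η]) (norm_nonneg _))
    exact (mul_le_mul (hgA η) hle (abs_nonneg _) (hgA0 η)).trans (hmono η)
  constructor
  · calc ‖biotSavart2D g ξ‖ = ‖∫ η, g η • biotSavartKernel2D (ξ - η)‖ := rfl
      _ ≤ ∫ η, bound η := norm_integral_le_of_norm_le hbi (Eventually.of_forall h1)
      _ ≤ ((2 * Real.pi)⁻¹ * (B * I₀ + 2 * M) + 1) * A / (1 + ‖ξ‖) := hfin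
  · rw [biotSavart2D, ← integral_inner hK, ← Real.norm_eq_abs]
    calc ‖∫ η, ⟪ξ, g η • biotSavartKernel2D (ξ - η)⟫‖
        ≤ ∫ η, bound η := norm_integral_le_of_norm_le hbi (Eventually.of_forall h2)
      _ ≤ ((2 * Real.pi)⁻¹ * (B * I₀ + 2 * M) + 1) * A / (1 + ‖ξ‖) := hfin

end Summit.AnomalousDissipation.AnomalousDissipation.Theorems.MarginalStabilityChainStretchedVortexRows

end
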